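import Summits.AnomalousDissipation.AnomalousDissipation.Theorems.SolenoidalFractalHomogenisationLagrangianStepCellLawVSlotWeightMonotone
import HarnessLib

/-!
# K1L `LagrangianRenormalisationStep(Design)` (K1L_D, stmt-AnomalousDissipation-27980), stub `stub_cellLawV0_IS`, IS-half obligation
# `stub_W_evenSlackB` — REFINED Loewner faces of the quasi-static slot response with the EXACT lag `r_T(x) = ϑ_∞/x − f_T(x)` (helper; word-independent)

Summits-side helper file of route `SolenoidalFractalHomogenisation` (prover seat `ad-sawtooth-k1loc-p1` g12; E1 even certificate, planner ad-ideate-p5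
g12 plan step (b), the anisotropic (110)-class slots).  `…CellLawVQSSpectral` (p679315) proved the inversion-bulk faces with the crude lag budget
`0 ≤ r_T ≤ 2/(ρT²a³)`, which spends `≈ 2/(ρT²) ≈ 4·10⁻³` — more than the radial slack `D(λ₀) ≈ 10⁻³` of the eigen-centred window.  Here the lag
is kept EXACT: with `r_T(x) := (1 − 4ρ/3)/x − f_T(x)` (`≥ 0`, `qsRespScalar_le`), which is NON-INCREASING in `x` (`respLag_antitone`, from the
monotonicity of `ϑ`, `mul_qsRespScalar_mono` p679911),
* **`sum_sum_mul_qsResp_mul_le_of_loewner'`** — UPPER face: `a ≤ B ≤ b` (Loewner, `a > 0`), `B₀ ≤ B`, `(q⁰_k, β⁰_k > 0)` an orthonormal eigenbasis of `B₀`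
  ⟹ `vᵀ f_T(B) v ≤ ϑ_∞ Σ_k (q⁰_k·v)²/β⁰_k − r_T(b)·|v|²`;
* **`sum_sum_mul_qsResp_mul_ge_of_loewner'`** — LOWER face: `a ≤ B` (`a > 0`), `B ≤ B₁`, `(q¹_k, β¹_k)` an orthonormal eigenbasis of `B₁`
  ⟹ `ϑ_∞ Σ_k (q¹_k·v)²/β¹_k − r_T(a)·|v|² ≤ vᵀ f_T(B) v`;
so the ORDER-REVERSAL DEFECT between the two faces on a block with spectrum in `[a, b]` is exactly `(r_T(a) − r_T(b))·|v|²` — the variation of the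
lag across the block's spectral width (`≈ 6(b − a)/(ρT²a⁴)`), not its size; `r_T` at the two points is available in closed form
(`qsRespScalar_eq_closed_form`).  Also `eig_le_of_loewner_ceiling`.  Everything PROVED, no definition, no named fact, no sorry.  Infrastructure for rung
leaf F-D1.A0; NOT a proof of the stub, of the crux, of Onsager's conjecture or of anomalous dissipation.
-/

set_option linter.dupNamespace false

noncomputable section

namespace Summit.AnomalousDissipation.AnomalousDissipation.Theorems.SolenoidalFractalHomogenisation.LagrangianStep

open Literature.Analysis Literature.Analysis.FluidPDE Literature.Analysis.FunctionSpaces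
open MeasureTheory Set Real Matrix

section Lag

/-- **The lag `r_T(x) = ϑ_∞/x − f_T(x)` is non-increasing in `x > 0`** (`T > 0`, `0 < ρ ≤ 1/2`): `ϑ_∞ − ϑ(ρ,Tx) ≥ 0` is non-increasing
(`ϑ` non-decreasing in its relaxation) and `1/x` is decreasing. [folklore] -/
theorem respLag_antitone {ρ T x y : ℝ} (hρ : 0 < ρ) (hρ2 : ρ ≤ 1 / 2) (hT : 0 < T) (hx : 0 < x) (hxy : x ≤ y) :
    (1 - 4 * ρ / 3) / y - qsRespScalar ρ T y ≤ (1 - 4 * ρ / 3) / x - qsRespScalar ρ T x := by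
  have hy : 0 < y := lt_of_lt_of_le hx hxy
  -- `ϑ(Tx) ≤ ϑ(Ty) ≤ ϑ_∞`
  have hmono : x * qsRespScalar ρ T x ≤ y * qsRespScalar ρ T y := mul_qsRespScalar_mono hρ hρ2 hT hx hxy
  have hup : y * qsRespScalar ρ T y ≤ 1 - 4 * ρ / 3 := by
    have h := OddGain.qsRespScalar_le hρ hρ2 hT.le hy
    rwa [le_div_iff₀ hy, mul_comm] at h
  -- `r(x) = (ϑ_∞ − x f(x))/x ≥ (ϑ_∞ − y f(y))/x ≥ (ϑ_∞ − y f(y))/y = r(y)`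
  have e1 : (1 - 4 * ρ / 3) / x - qsRespScalar ρ T x = ((1 - 4 * ρ / 3) - x * qsRespScalar ρ T x) / x := by
    field_simp
  have e2 : (1 - 4 * ρ / 3) / y - qsRespScalar ρ T y = ((1 - 4 * ρ / 3) - y * qsRespScalar ρ T y) / y := by
    field_simp
  rw [e1, e2]
  calc ((1 - 4 * ρ / 3) - y * qsRespScalar ρ T y) / y ≤ ((1 - 4 * ρ / 3) - y * qsRespScalar ρ T y) / x :=
        div_le_div_of_nonneg_left (by linarith) hx hxy
    _ ≤ ((1 - 4 * ρ / 3) - x * qsRespScalar ρ T x) / x := div_le_div_of_nonneg_right (by linarith) hx.le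

end Lag

section Faces

variable {m : ℕ}

/-- An eigenvalue is the Rayleigh quotient of its unit eigenvector; hence `β_k ≤ b` under the Loewner ceiling `B ≤ b`. [folklore] -/
theorem eig_le_of_loewner_ceiling {B : Matrix (Fin m) (Fin m) ℝ}
    (q : OrthonormalBasis (Fin m) ℝ (EuclideanSpace ℝ (Fin m))) (β : Fin m → ℝ)
    (hq : ∀ k, B.mulVec (q k) = β k • ⇑(q k)) {b : ℝ}
    (hb : ∀ w : Fin m → ℝ, ∑ i, ∑ j, w i * B i j * w j ≤ b * ∑ i, w i ^ 2) (k : Fin m) : β k ≤ b := by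
  -- apply the floor lemma to `−B ≥ −b`
  have hq' : ∀ k, (-B).mulVec (q k) = (fun k => -β k) k • ⇑(q k) := by
    intro k; rw [Matrix.neg_mulVec, hq k, neg_smul]
  have hb' : ∀ w : Fin m → ℝ, -b * ∑ i, w i ^ 2 ≤ ∑ i, ∑ j, w i * (-B) i j * w j := by
    intro w
    have h := hb w
    have e : ∑ i, ∑ j, w i * (-B) i j * w j = -∑ i, ∑ j, w i * B i j * w j := by
      simp only [Matrix.neg_apply, mul_neg, neg_mul, Finset.sum_neg_distrib]
    rw [e]; linarith
  have h := le_eig_of_loewner_floor q (fun k => -β k) hq' hb' k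
  linarith

/-- **UPPER FACE with the exact lag.**  `B` symmetric with `a ≤ B ≤ b` (`a > 0`) and `B₀ ≤ B` in the Loewner order; `(q⁰_k, β⁰_k)` an orthonormal
eigenbasis of the symmetric `B₀` with `β⁰_k > 0`; `T > 0`, `0 < ρ ≤ 1/2`.  Then
`vᵀ f_T(B) v ≤ ϑ_∞·Σ_k (q⁰_k·v)²/β⁰_k − r_T(b)·|v|²`, `r_T(b) = ϑ_∞/b − f_T(b)`, `ϑ_∞ = 1 − 4ρ/3`. [folklore] -/
theorem sum_sum_mul_qsResp_mul_le_of_loewner' {B B₀ : Matrix (Fin 3) (Fin 3) ℝ} (hB : B.IsSymm) (hB₀ : B₀.IsSymm)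
    {a b : ℝ} (ha0 : 0 < a) (ha : ∀ w : Fin 3 → ℝ, a * ∑ i, w i ^ 2 ≤ ∑ i, ∑ j, w i * B i j * w j)
    (hb : ∀ w : Fin 3 → ℝ, ∑ i, ∑ j, w i * B i j * w j ≤ b * ∑ i, w i ^ 2)
    (hle : ∀ w : Fin 3 → ℝ, ∑ i, ∑ j, w i * B₀ i j * w j ≤ ∑ i, ∑ j, w i * B i j * w j)
    (q : OrthonormalBasis (Fin 3) ℝ (EuclideanSpace ℝ (Fin 3))) (β : Fin 3 → ℝ)
    (hq : ∀ k, B₀.mulVec (q k) = β k • ⇑(q k)) (hβ : ∀ k, 0 < β k)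
    {ρ T : ℝ} (hρ : 0 < ρ) (hρ2 : ρ ≤ 1 / 2) (hT : 0 < T) (v : Fin 3 → ℝ) :
    ∑ i, ∑ j, v i * qsResp ρ T B i j * v j
      ≤ (1 - 4 * ρ / 3) * ∑ k, (∑ i, q k i * v i) ^ 2 / β k - ((1 - 4 * ρ / 3) / b - qsRespScalar ρ T b) * ∑ i, v i ^ 2 := by
  have hH : B.IsHermitian := isHermitian_of_isSymm hB
  set e := hH.eigenvectorBasis with he
  set γ := hH.eigenvalues with hγ
  have heq : ∀ k, B.mulVec (e k) = γ k • ⇑(e k) := fun k => hH.mulVec_eigenvectorBasis k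
  have hγa : ∀ k, a ≤ γ k := fun k => le_eig_of_loewner_floor e γ heq ha k
  have hγpos : ∀ k, 0 < γ k := fun k => lt_of_lt_of_le ha0 (hγa k)
  have hγb : ∀ k, γ k ≤ b := fun k => eig_le_of_loewner_ceiling e γ heq hb k
  rw [sum_sum_mul_qsResp_mul_self_eq_sum_eig hB e γ heq]
  have hpars : ∑ i, v i ^ 2 = ∑ k, (∑ i, e k i * v i) ^ 2 := by
    have h := sum_mul_eq_sum_eig e v v
    simpa only [sq] using h
  -- per eigen-direction: `f(γ_k) = ϑ_∞/γ_k − r(γ_k) ≤ ϑ_∞/γ_k − r(b)`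
  have hdir : ∀ k, qsRespScalar ρ T (γ k) ≤ (1 - 4 * ρ / 3) / γ k - ((1 - 4 * ρ / 3) / b - qsRespScalar ρ T b) := by
    intro k
    have h := respLag_antitone hρ hρ2 hT (hγpos k) (hγb k)
    linarith
  have h1 : ∑ k, qsRespScalar ρ T (γ k) * (∑ i, e k i * v i) ^ 2
      ≤ ∑ k, ((1 - 4 * ρ / 3) / γ k - ((1 - 4 * ρ / 3) / b - qsRespScalar ρ T b)) * (∑ i, e k i * v i) ^ 2 :=
    Finset.sum_le_sum fun k _ => mul_le_mul_of_nonneg_right (hdir k) (sq_nonneg _)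
  refine h1.trans ?_
  have h2 : ∑ k, ((1 - 4 * ρ / 3) / γ k - ((1 - 4 * ρ / 3) / b - qsRespScalar ρ T b)) * (∑ i, e k i * v i) ^ 2
      = (1 - 4 * ρ / 3) * ∑ k, (∑ i, e k i * v i) ^ 2 / γ k
        - ((1 - 4 * ρ / 3) / b - qsRespScalar ρ T b) * ∑ i, v i ^ 2 := by
    rw [hpars, Finset.mul_sum, Finset.mul_sum, ← Finset.sum_sub_distrib]
    exact Finset.sum_congr rfl fun k _ => by rw [sub_mul, div_mul_eq_mul_div, mul_div_assoc]
  rw [h2]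
  refine sub_le_sub_right (mul_le_mul_of_nonneg_left ?_ (by linarith)) _
  -- the bulk is order-reversing (variational characterisation)
  rw [← two_mul_sub_quad_eq_inv_form hB e γ heq v]
  set w : Fin 3 → ℝ := fun i => ∑ k, ((∑ j, e k j * v j) / γ k) * e k i
  calc 2 * ∑ i, v i * w i - ∑ i, ∑ j, w i * B i j * w j
      ≤ 2 * ∑ i, v i * w i - ∑ i, ∑ j, w i * B₀ i j * w j := by linarith [hle w]
    _ ≤ _ := two_mul_sub_quad_le_inv_form hB₀ q β hq hβ v w

/-- **LOWER FACE with the exact lag.**  `B` symmetric with `a ≤ B` (`a > 0`) and `B ≤ B₁` in the Loewner order; `(q¹_k, β¹_k)` an orthonormal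
eigenbasis of the symmetric `B₁`; `T > 0`, `0 < ρ ≤ 1/2`.  Then
`ϑ_∞·Σ_k (q¹_k·v)²/β¹_k − r_T(a)·|v|² ≤ vᵀ f_T(B) v`, `r_T(a) = ϑ_∞/a − f_T(a)`. [folklore] -/
theorem sum_sum_mul_qsResp_mul_ge_of_loewner' {B B₁ : Matrix (Fin 3) (Fin 3) ℝ} (hB : B.IsSymm) (hB₁ : B₁.IsSymm)
    {a : ℝ} (ha0 : 0 < a) (ha : ∀ w : Fin 3 → ℝ, a * ∑ i, w i ^ 2 ≤ ∑ i, ∑ j, w i * B i j * w j)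
    (hle : ∀ w : Fin 3 → ℝ, ∑ i, ∑ j, w i * B i j * w j ≤ ∑ i, ∑ j, w i * B₁ i j * w j)
    (q : OrthonormalBasis (Fin 3) ℝ (EuclideanSpace ℝ (Fin 3))) (β : Fin 3 → ℝ)
    (hq : ∀ k, B₁.mulVec (q k) = β k • ⇑(q k))
    {ρ T : ℝ} (hρ : 0 < ρ) (hρ2 : ρ ≤ 1 / 2) (hT : 0 < T) (v : Fin 3 → ℝ) :
    (1 - 4 * ρ / 3) * ∑ k, (∑ i, q k i * v i) ^ 2 / β k - ((1 - 4 * ρ / 3) / a - qsRespScalar ρ T a) * ∑ i, v i ^ 2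
      ≤ ∑ i, ∑ j, v i * qsResp ρ T B i j * v j := by
  have hH : B.IsHermitian := isHermitian_of_isSymm hB
  set e := hH.eigenvectorBasis with he
  set γ := hH.eigenvalues with hγ
  have heq : ∀ k, B.mulVec (e k) = γ k • ⇑(e k) := fun k => hH.mulVec_eigenvectorBasis k
  have hγa : ∀ k, a ≤ γ k := fun k => le_eig_of_loewner_floor e γ heq ha k
  have hγpos : ∀ k, 0 < γ k := fun k => lt_of_lt_of_le ha0 (hγa k)
  rw [sum_sum_mul_qsResp_mul_self_eq_sum_eig hB e γ heq]
  have hpars : ∑ i, v i ^ 2 = ∑ k, (∑ i, e k i * v i) ^ 2 := by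
    have h := sum_mul_eq_sum_eig e v v
    simpa only [sq] using h
  -- per eigen-direction: `f(γ_k) = ϑ_∞/γ_k − r(γ_k) ≥ ϑ_∞/γ_k − r(a)`
  have hdir : ∀ k, (1 - 4 * ρ / 3) / γ k - ((1 - 4 * ρ / 3) / a - qsRespScalar ρ T a) ≤ qsRespScalar ρ T (γ k) := by
    intro k
    have h := respLag_antitone hρ hρ2 hT ha0 (hγa k)
    linarith
  have h1 : ∑ k, ((1 - 4 * ρ / 3) / γ k - ((1 - 4 * ρ / 3) / a - qsRespScalar ρ T a)) * (∑ i, e k i * v i) ^ 2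
      ≤ ∑ k, qsRespScalar ρ T (γ k) * (∑ i, e k i * v i) ^ 2 :=
    Finset.sum_le_sum fun k _ => mul_le_mul_of_nonneg_right (hdir k) (sq_nonneg _)
  refine le_trans ?_ h1
  have h2 : ∑ k, ((1 - 4 * ρ / 3) / γ k - ((1 - 4 * ρ / 3) / a - qsRespScalar ρ T a)) * (∑ i, e k i * v i) ^ 2
      = (1 - 4 * ρ / 3) * ∑ k, (∑ i, e k i * v i) ^ 2 / γ k
        - ((1 - 4 * ρ / 3) / a - qsRespScalar ρ T a) * ∑ i, v i ^ 2 := by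
    rw [hpars, Finset.mul_sum, Finset.mul_sum, ← Finset.sum_sub_distrib]
    exact Finset.sum_congr rfl fun k _ => by rw [sub_mul, div_mul_eq_mul_div, mul_div_assoc]
  rw [h2]
  refine sub_le_sub_right (mul_le_mul_of_nonneg_left ?_ (by linarith)) _
  set w : Fin 3 → ℝ := fun i => ∑ k, ((∑ j, q k j * v j) / β k) * q k i
  calc ∑ k, (∑ i, q k i * v i) ^ 2 / β k
      = 2 * ∑ i, v i * w i - ∑ i, ∑ j, w i * B₁ i j * w j := (two_mul_sub_quad_eq_inv_form hB₁ q β hq v).symm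
    _ ≤ 2 * ∑ i, v i * w i - ∑ i, ∑ j, w i * B i j * w j := by linarith [hle w]
    _ ≤ _ := two_mul_sub_quad_le_inv_form hB e γ heq hγpos v w

end Faces

end Summit.AnomalousDissipation.AnomalousDissipation.Theorems.SolenoidalFractalHomogenisation.LagrangianStep
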